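import Summits.AtomisticToContinuum.FouriersLaw.Theorems.OddSectorIrreversibilityWitnessGlueCore
import Summits.AtomisticToContinuum.FouriersLaw.Theorems.OddSectorIrreversibilityWitnessGlueKernels
import Summits.AtomisticToContinuum.FouriersLaw.Theorems.OddSectorIrreversibilityBoundedResponseGreenKubo
import Summits.AtomisticToContinuum.FouriersLaw.Theorems.OddSectorIrreversibilityCorrectorTheoryUniformMixing

/-!
# Sketch — crux idea `single-scale-gk-witness` for `WitnessGlue` (stmt-AtomisticToContinuum-15160)

STATUS: `lean check` rc 0, 0 sorries, 0 errors; `witnessGlue_from_line : WitnessGlue` is a COMPLETE,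
kernel-checked proof of the crux against the live route file (axioms propext / Classical.choice /
Quot.sound; H21 audit: proof-of-item, closed = true). Planner seat (crux-ideate, ideator 2, round 1):
Theorems/ is prover-only, so this file is attached as a CANDIDATE PROOF on the item and published in
the crux directory; any prover may land it verbatim as
`Summits/AtomisticToContinuum/FouriersLaw/Theorems/OddSectorIrreversibilityWitnessGlueFlat.lean`
(rename the namespace, keep `theorem witnessGlue_from_line : WitnessGlue`) and close stmt-15160.

`WitnessGlue = TapLeakBound → ConeScaleCorrector → SubBallisticWindow → BoundedResponse` (rev 17).
The line: (i) Green–Kubo reduction — `BoundedResponse` follows from the EQUILIBRIUM bound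
`|GK_N(T)| ≤ C·N` eventually in `N` (landed `boundedResponse_of_correctorTheory_of_gk_abs_le` +
PROVED `CorrectorTheory_proof`), so the glue never touches a steady-state family or a response
coefficient (junk dichotomy: a non-integrable Green–Kubo integrand has `GK_N = 0`); (ii) scale
localisation — the single central block `[N/4, N-1-N/4)` with window `τ = a(N/4)/2` consumes the
tap-leak budget `P` only at `d ≥ N/4`, `s ≤ a d/2`, i.e. through the profile-free single-scale
budget `P♭ = TapLeakFlatAt` (rate `≤ C R/(N√N)`, `R = √((|⟨u,J⟩|+Z)Z)`); (iii) the landed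
single-block skeleton (`witness_inequality`, `integral_mul_bondCurrent_eq_of_sumRule`,
`le_of_sq_le_add_sqrt`) with the `E3` leak step replaced by `leak_bound_flat` — no tap-norm
integrability (`hsym`, Reflection file), no Liouville invariance, junk-tolerant time integral;
the order-3/2 bookkeeping closes: `T²D ≤ 64√(C₁C₂(1+a))/a + aγC₃/32 + (aγC₃T/8)√D`.

References: Kundu–Dhar–Narayan 2009 (open-chain Green–Kubo, (reln1)–(reln3)); Lepri–Livi–Politi
2003 §5 (finite-time Green–Kubo cut-off `t_c ∼ L`); Bonetto–Lebowitz–Rey-Bellet 2000 §6.3;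
Cuneo–Eckmann–Hairer–Rey-Bellet 2018 Thm 2.13 (fixed `N`); folklore.
-/

noncomputable section

namespace Summit.AtomisticToContinuum.FouriersLaw.Cruxes.WitnessGlue.SingleScaleGkWitness

open MeasureTheory Filter Topology ProbabilityTheory Set
open scoped NNReal ENNReal
open Literature.MathematicalPhysics.KineticTheory.HeatConduction
open Summit.AtomisticToContinuum.FouriersLaw.Theses.OddSectorIrreversibility
open Summit.AtomisticToContinuum.FouriersLaw.Theorems
open Summit.AtomisticToContinuum.FouriersLaw.Theorems.OddSectorWitness
open Summit.AtomisticToContinuum.FouriersLaw.Theorems.ClosedConeSensitivity.Negative.ZeroFrictionDictionary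

/-! ## (i) The Green–Kubo reduction: the glue's target is an equilibrium `O(N)` bound -/

/-- `GK_N(T) = ∫₀^∞ ∫ J (P_t J) dπ_{N,T} dt`, spelled exactly as in
`boundedResponse_of_correctorTheory_of_gk_abs_le` (a junk `0` if the integrand is not integrable). [folklore] -/
def gk (ω₂ lam β γ : ℝ) (N : ℕ) (T : ℝ) : ℝ :=
  ∫ t in Ioi (0 : ℝ), ∫ z, (∑ i : Fin N, (pinnedChain ω₂ lam β γ).bondCurrent N i z) *
      (∫ y, (∑ i : Fin N, (pinnedChain ω₂ lam β γ).bondCurrent N i y)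
        ∂((pinnedChain ω₂ lam β γ).transitionKernel N T T t.toNNReal z))
    ∂((pinnedChain ω₂ lam β γ).gibbsMeasure N T)

/-- The glue's target after the reduction: linear growth of the equilibrium Green–Kubo integral. [folklore] -/
def GKLinear : Prop :=
  ∀ ω₂ lam β γ : ℝ, 0 < ω₂ → 0 < lam → 0 < β → 0 < γ → ∀ T : ℝ, 0 < T →
    ∃ C : ℝ, ∀ᶠ N : ℕ in atTop, |gk ω₂ lam β γ N T| ≤ C * N

/-- **Composition (kernel of the line, PROVED):** an implication `P → E1 → E2 → GKLinear` closes the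
crux, through the landed Green–Kubo reduction and the proved fixed-`N` corrector theory. [folklore] -/
theorem witnessGlue_of_gkLinear
    (h : TapLeakBound → ConeScaleCorrector → SubBallisticWindow → GKLinear) : WitnessGlue :=
  fun hP hE1 hE2 => boundedResponse_of_correctorTheory_of_gk_abs_le
    OddSectorIrreversibility.Corrector.CorrectorTheory_proof (h hP hE1 hE2)

/-! ## (ii) Scale localisation: the single-scale tap-leak budget `P♭` -/

/-- `P♭ = TapLeakFlatAt ω₂ lam β γ T a C`: for `N ≥ 16`, every bond `i` of the central block
`[N/4, N-1-N/4)`, each contact `b`, the corrector `u` (same three clauses as in `TapLeakBound`) and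
every time `0 ≤ s ≤ a·N`, the tap-leak pairing is at most `C·√((|⟨u,J⟩|+Z)Z)/(N√N)` — ONE scale,
NO profile. Dictionary form (`j_i ∘ Φ_s` via `detFlow`, `μ_T = gibbsWeight`). [folklore] -/
def TapLeakFlatAt (ω₂ lam β γ T a C : ℝ) : Prop :=
  ∀ (N : ℕ) (i b : Fin N) (u : PhaseSpace N → ℝ) (s : ℝ), (b.val = 0 ∨ b.val = N - 1) → 0 ≤ s →
    16 ≤ N → N / 4 ≤ i.val → i.val < N - 1 - N / 4 →
    ContDiff ℝ 1 u → MemLp u 2 (gibbsWeight ω₂ lam β γ N T) →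
    (∀ᵐ x ∂(gibbsWeight ω₂ lam β γ N T), Tendsto (fun τ : ℝ => ∫ t in Ioc (0 : ℝ) τ,
        (∫ y, (∑ k : Fin N, (pinnedChain ω₂ lam β γ).bondCurrent N k y)
          ∂((pinnedChain ω₂ lam β γ).transitionKernel N T T t.toNNReal x))) atTop (𝓝 (u x))) →
    s ≤ a * N →
    |T * ∫ x, partialP b (fun y : PhaseSpace N => (u y + u (y.1, -y.2)) / 2) x *
        partialP b (fun y : PhaseSpace N => (pinnedChain ω₂ lam β γ).bondCurrent N i
          (detFlow ω₂ lam β N ((s.toNNReal : ℝ≥0) : ℝ) y)) x ∂(gibbsWeight ω₂ lam β γ N T)| ≤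
      C * Real.sqrt ((|∫ x, u x * (∑ k : Fin N, (pinnedChain ω₂ lam β γ).bondCurrent N k x)
            ∂(gibbsWeight ω₂ lam β γ N T)|
          + ∫ x, Real.exp (-((pinnedChain ω₂ lam β γ).hamiltonian N x) / T) ∂volume)
        * ∫ x, Real.exp (-((pinnedChain ω₂ lam β γ).hamiltonian N x) / T) ∂volume) /
        ((N : ℝ) * Real.sqrt N)

/-- **Step 1: `P ⇒ P♭`** with `a♭ = a/8`, `C♭ = 8^{3/2}·max C 0`: for `d ≥ N/4` and
`s ≤ aN/8 ≤ a d/2` one has `1 + (d - s/a) ≥ N/8`, so `(1 + (d - s/a))^{3/2} ≥ (N/8)^{3/2}`; the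
kernel integral of `TapLeakBound` is `j_i ∘ detFlow` by `integral_transitionKernel_zero_friction`.
[folklore] -/
theorem tapLeakFlatAt_of_tapLeakBound (hP : TapLeakBound) {ω₂ lam β γ : ℝ} (hω : 0 < ω₂)
    (hl : 0 < lam) (hβ : 0 < β) (hγ : 0 < γ) {T : ℝ} (hT : 0 < T) :
    ∃ a C : ℝ, 0 < a ∧ 0 ≤ C ∧ TapLeakFlatAt ω₂ lam β γ T a C := by
  obtain ⟨a, C, ha, h⟩ := hP ω₂ lam β γ hω hl hβ hγ T hT
  refine ⟨a / 8, max C 0 * (8 : ℝ) ^ (3 / 2 : ℝ), by positivity, by positivity, ?_⟩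
  intro N i b u s hb hs0 hN hi1 hi2 hu1 hu2 hu3 hsN
  -- the distance to the contact is at least `N/4`
  have hd4 : N / 4 ≤ (if b.val = 0 then i.val else N - 2 - i.val) := by
    split_ifs with h0
    · exact hi1
    · omega
  set d : ℕ := (if b.val = 0 then i.val else N - 2 - i.val) with hd
  have hq : N ≤ 4 * (N / 4) + 3 := by omega
  have hdR : ((N : ℝ) - 3) / 4 ≤ d := by
    have h1 : ((N / 4 : ℕ) : ℝ) ≤ d := by exact_mod_cast hd4
    have h2 : (N : ℝ) ≤ 4 * ((N / 4 : ℕ) : ℝ) + 3 := by exact_mod_cast hq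
    linarith
  have hN16 : (16 : ℝ) ≤ N := by exact_mod_cast hN
  have hsd : s ≤ a * (d : ℝ) := by
    have : a / 8 * (N : ℝ) ≤ a * (((N : ℝ) - 3) / 4) := by nlinarith
    exact hsN.trans (this.trans (mul_le_mul_of_nonneg_left hdR ha.le))
  -- the route's `P` at this instance, read through the zero-friction dictionary
  have key := h N i b u s hb hs0 hu1 hu2 hu3 hsd
  simp only [] at key
  simp_rw [integral_transitionKernel_zero_friction hω hl.le hβ.le] at key
  refine key.trans ?_
  -- compare the two right-hand sides
  set S : ℝ := Real.sqrt ((|∫ x, u x * (∑ k : Fin N, (pinnedChain ω₂ lam β γ).bondCurrent N k x)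
      ∂(gibbsWeight ω₂ lam β γ N T)| +
      ∫ x, Real.exp (-((pinnedChain ω₂ lam β γ).hamiltonian N x) / T) ∂volume) *
    ∫ x, Real.exp (-((pinnedChain ω₂ lam β γ).hamiltonian N x) / T) ∂volume) with hS
  have hS0 : 0 ≤ S := Real.sqrt_nonneg _
  have hsa : s / a ≤ (N : ℝ) / 8 := by
    rw [div_le_iff₀ ha]; linarith
  have hbase : (N : ℝ) / 8 ≤ 1 + ((d : ℝ) - s / a) := by linarith
  have hNpos : (0 : ℝ) < N := by linarith
  have hpow : ((N : ℝ) / 8) ^ (3 / 2 : ℝ) ≤ (1 + ((d : ℝ) - s / a)) ^ (3 / 2 : ℝ) :=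
    Real.rpow_le_rpow (by positivity) hbase (by norm_num)
  have h8 : (0 : ℝ) < (8 : ℝ) ^ (3 / 2 : ℝ) := by positivity
  have hNpow : ((N : ℝ) / 8) ^ (3 / 2 : ℝ) = (N : ℝ) ^ (3 / 2 : ℝ) / (8 : ℝ) ^ (3 / 2 : ℝ) :=
    Real.div_rpow hNpos.le (by norm_num) _
  have hN32 : (N : ℝ) ^ (3 / 2 : ℝ) = (N : ℝ) * Real.sqrt N := by
    rw [show (3 / 2 : ℝ) = 1 + 1 / 2 by norm_num, Real.rpow_add hNpos, Real.rpow_one, Real.sqrt_eq_rpow]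
  have hB0 : 0 < (N : ℝ) * Real.sqrt N / (8 : ℝ) ^ (3 / 2 : ℝ) := by positivity
  have hBle : (N : ℝ) * Real.sqrt N / (8 : ℝ) ^ (3 / 2 : ℝ) ≤ (1 + ((d : ℝ) - s / a)) ^ (3 / 2 : ℝ) := by
    rw [← hN32, ← hNpow]; exact hpow
  have hC : C ≤ max C 0 := le_max_left _ _
  calc C * S / (1 + ((d : ℝ) - s / a)) ^ (3 / 2 : ℝ)
      ≤ max C 0 * S / (1 + ((d : ℝ) - s / a)) ^ (3 / 2 : ℝ) := by
        gcongr
        · exact hB0.le.trans hBle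
    _ ≤ max C 0 * S / ((N : ℝ) * Real.sqrt N / (8 : ℝ) ^ (3 / 2 : ℝ)) :=
        div_le_div_of_nonneg_left (by positivity) hB0 hBle
    _ = max C 0 * (8 : ℝ) ^ (3 / 2 : ℝ) * S / ((N : ℝ) * Real.sqrt N) := by
        field_simp

/-! ## (iii) The leak at the flat rate, the single-block response bound, the pointwise `GK` bound -/

section Leak

variable {ω₂ lam β : ℝ} (hω : 0 < ω₂) (hl : 0 ≤ lam) (hβ : 0 ≤ β)
include hω hl hβ

omit hω hl hβ in
/-- **Step 2: the leak bound at the flat rate** (successor of the `E3`-shaped `leak_bound`):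
from the leak identity A(7) of `CorrectorTheory` and `P♭` at both contacts, for a central-block bond
and `0 < t ≤ a N`: `⟨u⁻, j_i∘Φ_t⟩ ≥ ⟨u⁻, j_i⟩ - γ·(2 C R/(N√N))·t`, `R = √((|⟨u,J⟩|+Z)Z)`.
No integrability of `∂_{p_b}u` is needed (`P♭` bounds the PAIRING), and the time integral is
junk-tolerant (`norm_setIntegral_le_of_norm_le_const`). [folklore] -/
theorem leak_bound_flat (γ : ℝ) (N : ℕ) {T : ℝ} (hT : 0 < T) (hγ : 0 ≤ γ)
    {a C : ℝ} (hC : 0 ≤ C) (hflat : TapLeakFlatAt ω₂ lam β γ T a C)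
    {u : PhaseSpace N → ℝ} (hu1 : ContDiff ℝ 1 u) (hu2 : MemLp u 2 (gibbsWeight ω₂ lam β γ N T))
    (hu3 : ∀ᵐ x ∂(gibbsWeight ω₂ lam β γ N T), Tendsto (fun τ : ℝ => ∫ t in Ioc (0 : ℝ) τ,
        (∫ y, (∑ k : Fin N, (pinnedChain ω₂ lam β γ).bondCurrent N k y)
          ∂((pinnedChain ω₂ lam β γ).transitionKernel N T T t.toNNReal x))) atTop (𝓝 (u x)))
    (b₀ b₁ : Fin N) (hb₀ : b₀.val = 0) (hb₁ : b₁.val = N - 1)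
    (hN : 16 ≤ N) (i : Fin N) (hi1 : N / 4 ≤ i.val) (hi2 : i.val < N - 1 - N / 4)
    (jt : ℝ → PhaseSpace N → ℝ)
    (hjt : ∀ s x, jt s x = (pinnedChain ω₂ lam β γ).bondCurrent N i (detFlow ω₂ lam β N ((s.toNNReal : ℝ≥0) : ℝ) x))
    (hA7 : ∀ t : ℝ, 0 ≤ t →
      (∫ x, (u x - u (x.1, -x.2)) / 2 * jt t x ∂(gibbsWeight ω₂ lam β γ N T)) -
        (∫ x, (u x - u (x.1, -x.2)) / 2 * (pinnedChain ω₂ lam β γ).bondCurrent N i x ∂(gibbsWeight ω₂ lam β γ N T)) =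
      -(γ * T) * ∫ s in Ioc (0 : ℝ) t,
        ((∫ x, partialP b₀ (fun y : PhaseSpace N => (u y + u (y.1, -y.2)) / 2) x * partialP b₀ (jt s) x
            ∂(gibbsWeight ω₂ lam β γ N T)) +
          ∫ x, partialP b₁ (fun y : PhaseSpace N => (u y + u (y.1, -y.2)) / 2) x * partialP b₁ (jt s) x
            ∂(gibbsWeight ω₂ lam β γ N T)))
    {t : ℝ} (ht : 0 < t) (htN : t ≤ a * N) :
    ∫ x, (u x - u (x.1, -x.2)) / 2 * (pinnedChain ω₂ lam β γ).bondCurrent N i x ∂(gibbsWeight ω₂ lam β γ N T) -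
      (γ * (2 * C * Real.sqrt ((|∫ x, u x * (∑ k : Fin N, (pinnedChain ω₂ lam β γ).bondCurrent N k x)
            ∂(gibbsWeight ω₂ lam β γ N T)|
          + ∫ x, Real.exp (-((pinnedChain ω₂ lam β γ).hamiltonian N x) / T) ∂volume)
        * ∫ x, Real.exp (-((pinnedChain ω₂ lam β γ).hamiltonian N x) / T) ∂volume) /
          ((N : ℝ) * Real.sqrt N))) * t ≤
    ∫ x, (u x - u (x.1, -x.2)) / 2 * (pinnedChain ω₂ lam β γ).bondCurrent N i (detFlow ω₂ lam β N t x)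
      ∂(gibbsWeight ω₂ lam β γ N T) := by
  set P := pinnedChain ω₂ lam β γ with hP
  set μ := gibbsWeight ω₂ lam β γ N T with hμ
  set Z : ℝ := ∫ x, Real.exp (-(P.hamiltonian N x) / T) ∂volume with hZ
  set R : ℝ := Real.sqrt ((|∫ x, u x * (∑ k : Fin N, P.bondCurrent N k x) ∂μ| + Z) * Z) with hR
  set ue : PhaseSpace N → ℝ := fun y => (u y + u (y.1, -y.2)) / 2 with hue
  have hR0 : 0 ≤ R := Real.sqrt_nonneg _
  have hNpos : (0 : ℝ) < N := by exact_mod_cast (show 0 < N by omega)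
  have hNs : (0 : ℝ) < (N : ℝ) * Real.sqrt N := mul_pos hNpos (Real.sqrt_pos.2 hNpos)
  set K : ℝ := C * R / ((N : ℝ) * Real.sqrt N) with hK
  have hK0 : 0 ≤ K := by positivity
  -- pointwise bound on each tap pairing, `s ∈ (0, t]`
  have hpt : ∀ b : Fin N, (b.val = 0 ∨ b.val = N - 1) → ∀ s ∈ Ioc (0 : ℝ) t,
      |T * ∫ x, partialP b ue x * partialP b (jt s) x ∂μ| ≤ K := by
    intro b hb s hs
    have hs0 : 0 ≤ s := hs.1.le
    have hsN : s ≤ a * N := hs.2.trans htN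
    have hj : jt s = fun y => P.bondCurrent N i (detFlow ω₂ lam β N ((s.toNNReal : ℝ≥0) : ℝ) y) :=
      funext (hjt s)
    rw [hj]
    exact hflat N i b u s hb hs0 hN hi1 hi2 hu1 hu2 hu3 hsN
  have hpt' : ∀ b : Fin N, (b.val = 0 ∨ b.val = N - 1) → ∀ s ∈ Ioc (0 : ℝ) t,
      |∫ x, partialP b ue x * partialP b (jt s) x ∂μ| ≤ K / T := by
    intro b hb s hs
    have h := hpt b hb s hs
    rw [abs_mul, abs_of_pos hT] at h
    rw [le_div_iff₀ hT]
    linarith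
  -- the time integral of the two pairings is at most `(2K/T)·t` (junk-tolerant: no measurability)
  have hI : |∫ s in Ioc (0 : ℝ) t,
      ((∫ x, partialP b₀ ue x * partialP b₀ (jt s) x ∂μ) + ∫ x, partialP b₁ ue x * partialP b₁ (jt s) x ∂μ)| ≤
      2 * K / T * t := by
    have h := norm_setIntegral_le_of_norm_le_const (μ := (volume : Measure ℝ)) (s := Ioc (0 : ℝ) t)
      (f := fun s => (∫ x, partialP b₀ ue x * partialP b₀ (jt s) x ∂μ) + ∫ x, partialP b₁ ue x * partialP b₁ (jt s) x ∂μ)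
      (C := 2 * K / T) measure_Ioc_lt_top ?_
    · rw [Real.volume_real_Ioc_of_le ht.le, sub_zero, Real.norm_eq_abs] at h
      exact h
    · intro s hs
      rw [Real.norm_eq_abs]
      have h0 := hpt' b₀ (Or.inl hb₀) s hs
      have h1 := hpt' b₁ (Or.inr hb₁) s hs
      calc |(∫ x, partialP b₀ ue x * partialP b₀ (jt s) x ∂μ) + ∫ x, partialP b₁ ue x * partialP b₁ (jt s) x ∂μ|
          ≤ |∫ x, partialP b₀ ue x * partialP b₀ (jt s) x ∂μ| + |∫ x, partialP b₁ ue x * partialP b₁ (jt s) x ∂μ| :=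
            abs_add_le _ _
        _ ≤ K / T + K / T := add_le_add h0 h1
        _ = 2 * K / T := by ring
  -- combine with the leak identity
  have hA := hA7 t ht.le
  have hjt_t : (fun x => (u x - u (x.1, -x.2)) / 2 * jt t x) =
      fun x => (u x - u (x.1, -x.2)) / 2 * P.bondCurrent N i (detFlow ω₂ lam β N t x) := by
    funext x; rw [hjt, Real.coe_toNNReal _ ht.le]
  rw [hjt_t] at hA
  have hγT : 0 ≤ γ * T := mul_nonneg hγ hT.le
  have key : |-(γ * T) * ∫ s in Ioc (0 : ℝ) t,
      ((∫ x, partialP b₀ ue x * partialP b₀ (jt s) x ∂μ) + ∫ x, partialP b₁ ue x * partialP b₁ (jt s) x ∂μ)| ≤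
      γ * (2 * K) * t := by
    rw [abs_mul, abs_neg, abs_of_nonneg hγT]
    calc γ * T * |∫ s in Ioc (0 : ℝ) t,
          ((∫ x, partialP b₀ ue x * partialP b₀ (jt s) x ∂μ) + ∫ x, partialP b₁ ue x * partialP b₁ (jt s) x ∂μ)|
        ≤ γ * T * (2 * K / T * t) := mul_le_mul_of_nonneg_left hI hγT
      _ = γ * (2 * K) * t := by field_simp
  have hK' : γ * (2 * C * Real.sqrt ((|∫ x, u x * (∑ k : Fin N, P.bondCurrent N k x) ∂μ| + Z) * Z) /
      ((N : ℝ) * Real.sqrt N)) * t = γ * (2 * K) * t := by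
    rw [hK]; ring
  rw [hK']
  have := neg_abs_le (-(γ * T) * ∫ s in Ioc (0 : ℝ) t,
      ((∫ x, partialP b₀ ue x * partialP b₀ (jt s) x ∂μ) + ∫ x, partialP b₁ ue x * partialP b₁ (jt s) x ∂μ))
  linarith [hA, key, this]

set_option maxHeartbeats 800000 in
/-- **Step 3: the response bound at one chain length `N ≥ 16` at the flat rate** — the landed
`response_bound` with (`hcone`, `κ`, `hsym`) replaced by `P♭` and the corrector clause `hu3`; `D` is
any real with `⟨u, J⟩_{μ_T} = Z (N-1) T² D` (in Step 4: `D := GK_N/((N-1)T²)`). Arithmetic: leak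
rate `L = 2γC₃R/(N√N)`, `R ≤ Z(1 + T√N√D)`, `τL/2 ≤ (aγC₃Z/8)(N^{-1/2} + T√D)`, so
`T²D ≤ 64√(C₁C₂(1+a))/a + aγC₃/32 + (aγC₃T/8)√D`. [folklore] -/
theorem response_bound_flat (γ : ℝ) (N : ℕ) {T : ℝ} (hT : 0 < T) (hγ : 0 < γ)
    {a C₁ C₂ C₃ : ℝ} (ha : 0 < a) (hC₁ : 0 ≤ C₁) (hC₂ : 0 ≤ C₂) (hC₃ : 0 ≤ C₃)
    (hflat : TapLeakFlatAt ω₂ lam β γ T a C₃)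
    (hN : 16 ≤ N) {D : ℝ}
    {u : PhaseSpace N → ℝ} (hu1 : ContDiff ℝ 1 u) (hu2 : MemLp u 2 (gibbsWeight ω₂ lam β γ N T))
    (hu3 : ∀ᵐ x ∂(gibbsWeight ω₂ lam β γ N T), Tendsto (fun τ : ℝ => ∫ t in Ioc (0 : ℝ) τ,
        (∫ y, (∑ k : Fin N, (pinnedChain ω₂ lam β γ).bondCurrent N k y)
          ∂((pinnedChain ω₂ lam β γ).transitionKernel N T T t.toNNReal x))) atTop (𝓝 (u x)))
    (h5 : ∀ i i' : Fin N, i'.val = i.val + 1 → i'.val + 1 < N →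
      ∫ x, u x * (pinnedChain ω₂ lam β γ).bondCurrent N i x ∂(gibbsWeight ω₂ lam β γ N T) =
        ∫ x, u x * (pinnedChain ω₂ lam β γ).bondCurrent N i' x ∂(gibbsWeight ω₂ lam β γ N T))
    (b₀ b₁ : Fin N) (hb₀ : b₀.val = 0) (hb₁ : b₁.val = N - 1)
    (h6 : γ * T * ((∫ x, (partialP b₀ u x) ^ 2 ∂(gibbsWeight ω₂ lam β γ N T)) +
        ∫ x, (partialP b₁ u x) ^ 2 ∂(gibbsWeight ω₂ lam β γ N T)) =
      ∫ x, u x * (∑ i : Fin N, (pinnedChain ω₂ lam β γ).bondCurrent N i x) ∂(gibbsWeight ω₂ lam β γ N T))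
    (jt : Fin N → ℝ → PhaseSpace N → ℝ)
    (hjt : ∀ i s x, jt i s x = (pinnedChain ω₂ lam β γ).bondCurrent N i (detFlow ω₂ lam β N ((s.toNNReal : ℝ≥0) : ℝ) x))
    (hA7 : ∀ (i : Fin N) (t : ℝ), 0 ≤ t →
      (∫ x, (u x - u (x.1, -x.2)) / 2 * jt i t x ∂(gibbsWeight ω₂ lam β γ N T)) -
        (∫ x, (u x - u (x.1, -x.2)) / 2 * (pinnedChain ω₂ lam β γ).bondCurrent N i x ∂(gibbsWeight ω₂ lam β γ N T)) =
      -(γ * T) * ∫ s in Ioc (0 : ℝ) t,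
        ((∫ x, partialP b₀ (fun y : PhaseSpace N => (u y + u (y.1, -y.2)) / 2) x * partialP b₀ (jt i s) x
            ∂(gibbsWeight ω₂ lam β γ N T)) +
          ∫ x, partialP b₁ (fun y : PhaseSpace N => (u y + u (y.1, -y.2)) / 2) x * partialP b₁ (jt i s) x
            ∂(gibbsWeight ω₂ lam β γ N T)))
    (hGK : ∫ x, u x * (∑ i : Fin N, (pinnedChain ω₂ lam β γ).bondCurrent N i x) ∂(gibbsWeight ω₂ lam β γ N T) =
      (∫ x, Real.exp (-((pinnedChain ω₂ lam β γ).hamiltonian N x) / T) ∂volume) * (((N : ℝ) - 1) * T ^ 2 * D))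
    (hE1 : ∫ x, (u x) ^ 2 ∂(gibbsWeight ω₂ lam β γ N T) ≤
      C₁ * (N : ℝ) ^ 2 * ∫ x, Real.exp (-((pinnedChain ω₂ lam β γ).hamiltonian N x) / T) ∂volume)
    (hE2 : ∀ k₁ k₂ : ℕ, k₁ ≤ k₂ → k₂ + 1 ≤ N → ∀ τ : ℝ, 0 ≤ τ →
      ∫ x, (window ω₂ lam β γ N k₁ k₂ τ x) ^ 2 ∂(gibbsWeight ω₂ lam β γ N T) ≤
        C₂ * (1 + τ) * ((k₂ : ℝ) - k₁) * ∫ x, Real.exp (-((pinnedChain ω₂ lam β γ).hamiltonian N x) / T) ∂volume) :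
    0 ≤ D ∧ D ≤ 2 * (64 * Real.sqrt (C₁ * C₂ * (1 + a)) / a + a * γ * C₃ / 32) / T ^ 2 +
      (a * γ * C₃ * T / 8) ^ 2 / T ^ 4 := by
  set P := pinnedChain ω₂ lam β γ
  set μ := gibbsWeight ω₂ lam β γ N T
  set Z : ℝ := ∫ x, Real.exp (-(P.hamiltonian N x) / T) ∂volume with hZdef
  set K₁ : ℝ := 64 * Real.sqrt (C₁ * C₂ * (1 + a)) / a with hK₁
  set c₀ : ℝ := a * γ * C₃ / 32 with hc₀
  set c₄ : ℝ := a * γ * C₃ * T / 8 with hc₄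
  have hZ : 0 < Z := integral_exp_pos (pinnedChain_integrable_gibbsDensity hω hl hβ γ N hT)
  have hN2 : (2 : ℝ) ≤ N := by exact_mod_cast (show 2 ≤ N by omega)
  have hN1 : 0 < (N : ℝ) - 1 := by linarith
  have hK₁0 : 0 ≤ K₁ := by positivity
  have hc₀0 : 0 ≤ c₀ := by positivity
  have hc₄0 : 0 ≤ c₄ := by positivity
  -- Step A: `D ≥ 0` from the tap identity (junk-valued integrals included)
  have hΛ'0 : 0 ≤ (∫ x, (partialP b₀ u x) ^ 2 ∂μ) + ∫ x, (partialP b₁ u x) ^ 2 ∂μ :=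
    add_nonneg (integral_nonneg fun _ => sq_nonneg _) (integral_nonneg fun _ => sq_nonneg _)
  have hGK' : γ * T * ((∫ x, (partialP b₀ u x) ^ 2 ∂μ) + ∫ x, (partialP b₁ u x) ^ 2 ∂μ) =
      Z * (((N : ℝ) - 1) * T ^ 2 * D) := h6.trans hGK
  have hD0 : 0 ≤ D := by
    have h1 : 0 ≤ Z * (((N : ℝ) - 1) * T ^ 2 * D) := by
      rw [← hGK']; exact mul_nonneg (mul_nonneg hγ.le hT.le) hΛ'0
    have h2 : 0 < Z * (((N : ℝ) - 1) * T ^ 2) := by positivity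
    rw [show Z * (((N : ℝ) - 1) * T ^ 2 * D) = (Z * (((N : ℝ) - 1) * T ^ 2)) * D by ring] at h1
    exact nonneg_of_mul_nonneg_right h1 h2
  refine ⟨hD0, ?_⟩
  -- the block, the window, the static pairing
  set q : ℕ := N / 4 with hq
  have hq4 : 4 * q ≤ N := Nat.mul_div_le N 4
  have hqlt : N < 4 * q + 4 := by omega
  have hq1 : 4 ≤ q := by omega
  set k₂ : ℕ := N - 1 - q with hk₂def
  have hk : q ≤ k₂ := by omega
  have hk₂ : k₂ + 1 ≤ N := by omega
  set τ : ℝ := a * q / 2 with hτ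
  have hτ0 : 0 < τ := by positivity
  set s : ℝ := Z * T ^ 2 * D with hs
  have hS : ∀ i : Fin N, q ≤ i.val → i.val < k₂ → ∫ x, u x * P.bondCurrent N i x ∂μ = s := by
    intro i _ hi2
    refine integral_mul_bondCurrent_eq_of_sumRule hω hl hβ γ N hT hu2 h5 ?_ i (by omega)
    rw [hGK]; ring
  -- the flat leak rate
  set R : ℝ := Real.sqrt ((|∫ x, u x * (∑ k : Fin N, P.bondCurrent N k x) ∂μ| + Z) * Z) with hRdef
  have hR0 : 0 ≤ R := Real.sqrt_nonneg _
  have hNpos : (0 : ℝ) < N := by linarith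
  have hsN0 : 0 < Real.sqrt (N : ℝ) := Real.sqrt_pos.2 hNpos
  set L : ℝ := γ * (2 * C₃ * R / ((N : ℝ) * Real.sqrt N)) with hL
  have hL0 : 0 ≤ L := by positivity
  have hqr4 : (4 : ℝ) ≤ q := by exact_mod_cast hq1
  have hq4r : 4 * (q : ℝ) ≤ N := by exact_mod_cast hq4
  have hτN : τ ≤ a * N := by
    rw [hτ, show a * (q : ℝ) / 2 = a * (q / 2) by ring]
    exact mul_le_mul_of_nonneg_left (by linarith only [hq4r, hqr4]) ha.le
  have hLeak : ∀ i : Fin N, q ≤ i.val → i.val < k₂ → ∀ t : ℝ, 0 < t → t ≤ τ →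
      ∫ x, (u x - u (x.1, -x.2)) / 2 * P.bondCurrent N i x ∂μ - L * t ≤
        ∫ x, (u x - u (x.1, -x.2)) / 2 * P.bondCurrent N i (detFlow ω₂ lam β N t x) ∂μ := by
    intro i hi1 hi2 t ht htτ
    exact leak_bound_flat γ N hT hγ.le hC₃ hflat hu1 hu2 hu3 b₀ b₁ hb₀ hb₁ hN i hi1 (by omega)
      (jt i) (hjt i) (hA7 i) ht (htτ.trans hτN)
  have hW := witness_inequality hω hl hβ γ N hT hu2 hk (by omega) hτ0.le hS hLeak
  -- real-arithmetic facts about the block and the window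
  set Br : ℝ := (k₂ : ℝ) - q with hBrdef
  have hqN : (N : ℝ) ≤ 8 * q := by
    have : (N : ℝ) < 4 * q + 4 := by exact_mod_cast hqlt
    linarith
  have hBr_eq : Br = (N : ℝ) - 1 - 2 * q := by
    rw [hBrdef, hk₂def, Nat.cast_sub (by omega), Nat.cast_sub (by omega), Nat.cast_one]
    ring
  have hN16 : (16 : ℝ) ≤ N := by exact_mod_cast hN
  have hBr : (N : ℝ) / 4 ≤ Br := by rw [hBr_eq]; linarith only [hq4r, hN16]
  have hBr' : Br ≤ N := by rw [hBr_eq]; linarith only [hqr4]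
  have hBr0 : 0 < Br := by linarith only [hBr, hN2]
  have hBrτ : a * (N : ℝ) ^ 2 / 64 ≤ Br * τ := by
    rw [hτ]
    have : a * (N : ℝ) ^ 2 / 64 ≤ ((N : ℝ) / 4) * (a * q / 2) := by
      rw [show a * (N : ℝ) ^ 2 / 64 = (a * N / 8) * (N / 8) by ring,
        show ((N : ℝ) / 4) * (a * q / 2) = (a * N / 8) * q by ring]
      exact mul_le_mul_of_nonneg_left (by linarith only [hqN]) (by positivity)
    exact this.trans (mul_le_mul_of_nonneg_right hBr (by positivity))
  -- `E1`, `E2` ⇒ the Cauchy–Schwarz right-hand side is `≤ Z N² √(C₁C₂(1+a))`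
  set K : ℝ := C₁ * C₂ * (1 + a) with hKdef
  have hK0 : 0 ≤ K := by positivity
  have hE2' := hE2 q k₂ hk hk₂ τ hτ0.le
  have hRR : Real.sqrt (∫ x, (u x) ^ 2 ∂μ) * Real.sqrt (∫ x, (window ω₂ lam β γ N q k₂ τ x) ^ 2 ∂μ) ≤
      Z * (N : ℝ) ^ 2 * Real.sqrt K := by
    have h1 := Real.sqrt_le_sqrt hE1
    have h2 := Real.sqrt_le_sqrt hE2'
    have h12 := mul_le_mul h1 h2 (Real.sqrt_nonneg _) (Real.sqrt_nonneg _)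
    refine h12.trans ?_
    rw [← Real.sqrt_mul (by positivity)]
    have hprod : (1 + τ) * Br ≤ (1 + a) * (N : ℝ) ^ 2 := by
      have h1N : (1 : ℝ) ≤ N := by linarith only [hN2]
      have : 1 + τ ≤ (1 + a) * N := by
        rw [show (1 + a) * (N : ℝ) = N + a * N by ring]; linarith only [hτN, h1N]
      calc (1 + τ) * Br ≤ ((1 + a) * N) * N := mul_le_mul this hBr' hBr0.le (by positivity)
        _ = (1 + a) * (N : ℝ) ^ 2 := by ring
    have hle : C₁ * (N : ℝ) ^ 2 * Z * (C₂ * (1 + τ) * Br * Z) ≤ (Z * (N : ℝ) ^ 2 * Real.sqrt K) ^ 2 := by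
      calc C₁ * (N : ℝ) ^ 2 * Z * (C₂ * (1 + τ) * Br * Z) = (C₁ * C₂ * Z ^ 2 * (N : ℝ) ^ 2) * ((1 + τ) * Br) := by ring
        _ ≤ (C₁ * C₂ * Z ^ 2 * (N : ℝ) ^ 2) * ((1 + a) * (N : ℝ) ^ 2) :=
            mul_le_mul_of_nonneg_left hprod (by positivity)
        _ = (Z * (N : ℝ) ^ 2 * Real.sqrt K) ^ 2 := by
            rw [mul_pow, mul_pow, Real.sq_sqrt hK0, hKdef]; ring
    calc Real.sqrt (C₁ * (N : ℝ) ^ 2 * Z * (C₂ * (1 + τ) * Br * Z)) ≤ Real.sqrt ((Z * (N : ℝ) ^ 2 * Real.sqrt K) ^ 2) :=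
          Real.sqrt_le_sqrt hle
      _ = Z * (N : ℝ) ^ 2 * Real.sqrt K := Real.sqrt_sq (by positivity)
  -- the flat leak rate in terms of `D`: `R ≤ Z (1 + T √N √D)` and `τ L / 2 ≤ Z (c₀ + c₄ √D)`
  have hRle : R ≤ Z * (1 + T * Real.sqrt N * Real.sqrt D) := by
    have huJ : |∫ x, u x * (∑ k : Fin N, P.bondCurrent N k x) ∂μ| = Z * (((N : ℝ) - 1) * T ^ 2 * D) := by
      rw [hGK]; exact abs_of_nonneg (by positivity)
    rw [hRdef, huJ]
    have hsq : (Z * (((N : ℝ) - 1) * T ^ 2 * D) + Z) * Z ≤ (Z * (1 + T * Real.sqrt N * Real.sqrt D)) ^ 2 := by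
      have hD' := Real.sq_sqrt hD0
      have hN' := Real.sq_sqrt hNpos.le
      have hx : 0 ≤ T * Real.sqrt N * Real.sqrt D := by positivity
      have : ((N : ℝ) - 1) * T ^ 2 * D + 1 ≤ (1 + T * Real.sqrt N * Real.sqrt D) ^ 2 := by
        have e : (1 + T * Real.sqrt N * Real.sqrt D) ^ 2 =
            1 + 2 * (T * Real.sqrt N * Real.sqrt D) + T ^ 2 * (Real.sqrt N) ^ 2 * (Real.sqrt D) ^ 2 := by ring
        rw [e, hN', hD']
        have hTD : 0 ≤ T ^ 2 * D := by positivity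
        nlinarith [hTD, hx]
      calc (Z * (((N : ℝ) - 1) * T ^ 2 * D) + Z) * Z = Z ^ 2 * (((N : ℝ) - 1) * T ^ 2 * D + 1) := by ring
        _ ≤ Z ^ 2 * (1 + T * Real.sqrt N * Real.sqrt D) ^ 2 := mul_le_mul_of_nonneg_left this (by positivity)
        _ = (Z * (1 + T * Real.sqrt N * Real.sqrt D)) ^ 2 := by ring
    calc Real.sqrt ((Z * (((N : ℝ) - 1) * T ^ 2 * D) + Z) * Z)
        ≤ Real.sqrt ((Z * (1 + T * Real.sqrt N * Real.sqrt D)) ^ 2) := Real.sqrt_le_sqrt hsq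
      _ = Z * (1 + T * Real.sqrt N * Real.sqrt D) := Real.sqrt_sq (by positivity)
  have hτL : τ * L / 2 ≤ Z * (c₀ + c₄ * Real.sqrt D) := by
    rw [hτ, hL, hc₀, hc₄]
    have hs4 : (4 : ℝ) ≤ Real.sqrt N := by
      rw [show (4 : ℝ) = Real.sqrt 16 by rw [show (16 : ℝ) = 4 ^ 2 by norm_num, Real.sqrt_sq (by norm_num)]]
      exact Real.sqrt_le_sqrt hN16
    have hNs : (0 : ℝ) < (N : ℝ) * Real.sqrt N := mul_pos hNpos hsN0
    -- `(a q /2) · γ · (2 C₃ R/(N√N)) / 2 = a γ C₃ · (q R) / (2 N √N)` and `q ≤ N/4`, `R ≤ Z(1 + T√N√D)`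
    have h1 : (q : ℝ) * R ≤ ((N : ℝ) / 4) * (Z * (1 + T * Real.sqrt N * Real.sqrt D)) :=
      mul_le_mul (by linarith only [hq4r]) hRle hR0 (by positivity)
    have h2 : a * ↑q / 2 * (γ * (2 * C₃ * R / (↑N * Real.sqrt ↑N))) / 2 =
        (a * γ * C₃ / 2) * ((q : ℝ) * R) / ((N : ℝ) * Real.sqrt N) := by
      field_simp
    rw [h2]
    have h3 : (a * γ * C₃ / 2) * ((q : ℝ) * R) / ((N : ℝ) * Real.sqrt N) ≤
        (a * γ * C₃ / 2) * (((N : ℝ) / 4) * (Z * (1 + T * Real.sqrt N * Real.sqrt D))) / ((N : ℝ) * Real.sqrt N) := by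
      gcongr
    refine h3.trans ?_
    rw [div_le_iff₀ hNs]
    -- reduce to `Z a γ C₃ N (1 + T√N√D)/8 ≤ Z a γ C₃ N √N (1/32·... )`: i.e. `1 ≤ √N/4`
    have h4 : (1 : ℝ) + T * Real.sqrt N * Real.sqrt D ≤ Real.sqrt N * (1 / 4 + T * Real.sqrt D) := by
      have e : Real.sqrt N * (1 / 4 + T * Real.sqrt D) = Real.sqrt N / 4 + T * Real.sqrt N * Real.sqrt D := by ring
      rw [e]; linarith [hs4]
    have h5 : 0 ≤ a * γ * C₃ / 2 * ((N : ℝ) / 4) * Z := by positivity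
    calc a * γ * C₃ / 2 * (↑N / 4 * (Z * (1 + T * Real.sqrt ↑N * Real.sqrt D)))
        = (a * γ * C₃ / 2 * ((N : ℝ) / 4) * Z) * (1 + T * Real.sqrt N * Real.sqrt D) := by ring
      _ ≤ (a * γ * C₃ / 2 * ((N : ℝ) / 4) * Z) * (Real.sqrt N * (1 / 4 + T * Real.sqrt D)) :=
          mul_le_mul_of_nonneg_left h4 h5
      _ = Z * (a * γ * C₃ / 32 + a * γ * C₃ * T / 8 * Real.sqrt D) * (↑N * Real.sqrt ↑N) := by ring
  -- (I): the witness inequality with `E1`, `E2`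
  have hI : Br * Z * τ * (T ^ 2 * D) ≤ Z * (N : ℝ) ^ 2 * Real.sqrt K + Br * τ * (τ * L / 2) := by
    have h1 : Br * (s * τ - L * τ ^ 2 / 2) ≤ Z * (N : ℝ) ^ 2 * Real.sqrt K := hW.trans hRR
    rw [hs] at h1
    linarith only [h1]
  -- (II): the two comparison facts
  have hA : Z * (N : ℝ) ^ 2 * Real.sqrt K ≤ Br * Z * τ * K₁ := by
    rw [hK₁]
    have : (N : ℝ) ^ 2 ≤ Br * τ * (64 / a) := by
      rw [mul_div_assoc', le_div_iff₀ ha]; linarith only [hBrτ]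
    calc Z * (N : ℝ) ^ 2 * Real.sqrt K ≤ Z * (Br * τ * (64 / a)) * Real.sqrt K := by gcongr
      _ = Br * Z * τ * (64 * Real.sqrt K / a) := by ring
  have hB : Br * τ * (τ * L / 2) ≤ Br * Z * τ * (c₀ + c₄ * Real.sqrt D) := by
    calc Br * τ * (τ * L / 2) ≤ Br * τ * (Z * (c₀ + c₄ * Real.sqrt D)) :=
          mul_le_mul_of_nonneg_left hτL (by positivity)
      _ = Br * Z * τ * (c₀ + c₄ * Real.sqrt D) := by ring
  -- (III): conclude
  have hmain : T ^ 2 * D ≤ (K₁ + c₀) + c₄ * Real.sqrt D := by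
    have hpos : 0 < Br * Z * τ := by positivity
    have : Br * Z * τ * (T ^ 2 * D) ≤ Br * Z * τ * ((K₁ + c₀) + c₄ * Real.sqrt D) := by
      linarith only [hI, hA, hB]
    exact le_of_mul_le_mul_left this hpos
  exact le_of_sq_le_add_sqrt hT hD0 hmain

end Leak

/-- **Step 4: the pointwise equilibrium bound.** At one admissible parameter point and
temperature, `P♭`, `E1` and `E2` (dictionary forms, constants fixed) give `|GK_N(T)| ≤ K·N` for every
`N ≥ 16`: take `u = u_N` from `correctorCalculus` (= conjunct A of the PROVED `CorrectorTheory`); if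
the Green–Kubo integrand is not integrable on `(0,∞)`, `GK_N = 0`; else
`⟨u_N, J⟩_{μ_T} = Z·GK_N` (`integral_corrector_mul_eq`, uniqueness from `NessUnique_holds`), and
Step 3 with `D := GK_N/((N-1)T²)` bounds it. No steady-state family appears. [folklore] -/
theorem gk_abs_le_of_flat {ω₂ lam β γ : ℝ} (hω : 0 < ω₂) (hl : 0 < lam) (hβ : 0 < β) (hγ : 0 < γ)
    {T : ℝ} (hT : 0 < T) {a C₁ C₂ C₃ : ℝ} (ha : 0 < a) (hC₁ : 0 ≤ C₁) (hC₂ : 0 ≤ C₂) (hC₃ : 0 ≤ C₃)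
    (hflat : TapLeakFlatAt ω₂ lam β γ T a C₃)
    (hE1 : ∀ (N : ℕ) (u : PhaseSpace N → ℝ),
      (∀ᵐ x ∂(gibbsWeight ω₂ lam β γ N T), Tendsto (fun τ : ℝ => ∫ t in Ioc (0 : ℝ) τ,
        (∫ y, (∑ k : Fin N, (pinnedChain ω₂ lam β γ).bondCurrent N k y)
          ∂((pinnedChain ω₂ lam β γ).transitionKernel N T T t.toNNReal x))) atTop (𝓝 (u x))) →
      MemLp u 2 (gibbsWeight ω₂ lam β γ N T) ∧
        ∫ x, (u x) ^ 2 ∂(gibbsWeight ω₂ lam β γ N T) ≤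
          C₁ * (N : ℝ) ^ 2 * ∫ x, Real.exp (-((pinnedChain ω₂ lam β γ).hamiltonian N x) / T) ∂volume)
    (hE2 : ∀ (N k₁ k₂ : ℕ), k₁ ≤ k₂ → k₂ + 1 ≤ N → ∀ τ : ℝ, 0 ≤ τ →
      ∫ x, (window ω₂ lam β γ N k₁ k₂ τ x) ^ 2 ∂(gibbsWeight ω₂ lam β γ N T) ≤
        C₂ * (1 + τ) * ((k₂ : ℝ) - k₁) * ∫ x, Real.exp (-((pinnedChain ω₂ lam β γ).hamiltonian N x) / T) ∂volume) :
    ∀ N : ℕ, 16 ≤ N →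
      |gk ω₂ lam β γ N T| ≤
        (2 * (64 * Real.sqrt (C₁ * C₂ * (1 + a)) / a + a * γ * C₃ / 32) + (a * γ * C₃) ^ 2 / 64) * N := by
  intro N hN
  set P := pinnedChain ω₂ lam β γ with hPdef
  set μ := gibbsWeight ω₂ lam β γ N T with hμdef
  set K₁' : ℝ := 64 * Real.sqrt (C₁ * C₂ * (1 + a)) / a + a * γ * C₃ / 32 with hK₁'
  have hK₁'0 : 0 ≤ K₁' := by positivity
  have hNpos : 0 < N := by omega
  have hN2 : (2 : ℝ) ≤ N := by exact_mod_cast (show 2 ≤ N by omega)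
  have hN1 : 0 < (N : ℝ) - 1 := by linarith
  -- junk dichotomy: a non-integrable Green–Kubo integrand gives `GK_N = 0`
  by_cases hint : IntegrableOn (fun t : ℝ => ∫ z, (∑ i : Fin N, P.bondCurrent N i z) *
      (∫ y, (∑ i : Fin N, P.bondCurrent N i y) ∂(P.transitionKernel N T T t.toNNReal z)) ∂(P.gibbsMeasure N T)) (Ioi 0)
  swap
  · have h0 : gk ω₂ lam β γ N T = 0 := integral_undef hint
    rw [h0, abs_zero]; positivity
  -- the corrector `u_N` (conjunct A of the PROVED `CorrectorTheory`)
  obtain ⟨u, hu1, hu2, hu3, hu4, h5, h6, h7⟩ :=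
    OddSectorIrreversibility.Corrector.correctorCalculus ω₂ lam β γ hω hl hβ hγ T hT N
  -- the Green–Kubo pairing identity `⟨u, J⟩_{μ_T} = Z · GK_N`
  have hU : ∀ μ' ν : Measure (PhaseSpace N), P.IsSteadyState N T T μ' → P.IsSteadyState N T T ν → μ' = ν :=
    fun μ' ν hμ' hν => NessUnique_holds ω₂ lam β γ hω hl hβ hγ N T T hT hT μ' ν hμ' hν
  have hJc : Continuous (fun z : PhaseSpace N => ∑ i : Fin N, P.bondCurrent N i z) :=
    continuous_finsetSum _ fun i _ => pinnedChain_continuous_bondCurrent ω₂ lam β γ N i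
  have hJ2 : MemLp (fun z : PhaseSpace N => ∑ i : Fin N, P.bondCurrent N i z) 2 μ :=
    memLp_finsetSum _ fun i _ => memLp_bondCurrent hω hl.le hβ.le γ N hT i
  have hGKid := integral_corrector_mul_eq hω hl.le hβ.le hT hβ hγ hNpos hU hJc hJ2 hu2 hu4 hint rfl
  set Z : ℝ := ∫ x, Real.exp (-(P.hamiltonian N x) / T) ∂volume with hZdef
  set D : ℝ := gk ω₂ lam β γ N T / (((N : ℝ) - 1) * T ^ 2) with hDdef
  have hne : ((N : ℝ) - 1) * T ^ 2 ≠ 0 := mul_ne_zero hN1.ne' (by positivity)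
  have hgk : gk ω₂ lam β γ N T = ((N : ℝ) - 1) * T ^ 2 * D := by
    rw [hDdef]; field_simp
  have hGK : ∫ x, u x * (∑ i : Fin N, P.bondCurrent N i x) ∂μ = Z * (((N : ℝ) - 1) * T ^ 2 * D) := by
    rw [← hgk]; exact hGKid
  -- A(7) through the zero-friction dictionary
  set jt : Fin N → ℝ → PhaseSpace N → ℝ := fun i s x =>
    ∫ y, P.bondCurrent N i y ∂((pinnedChain ω₂ lam β 0).transitionKernel N T T s.toNNReal x) with hjtdef
  have hjt : ∀ i s x, jt i s x = P.bondCurrent N i (detFlow ω₂ lam β N ((s.toNNReal : ℝ≥0) : ℝ) x) :=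
    fun i s x => integral_transitionKernel_zero_friction hω hl.le hβ.le N T T _ x _
  set b₀ : Fin N := ⟨0, by omega⟩
  set b₁ : Fin N := ⟨N - 1, by omega⟩
  have hA7 : ∀ (i : Fin N) (t : ℝ), 0 ≤ t →
      (∫ x, (u x - u (x.1, -x.2)) / 2 * jt i t x ∂μ) -
        (∫ x, (u x - u (x.1, -x.2)) / 2 * P.bondCurrent N i x ∂μ) =
      -(γ * T) * ∫ s in Ioc (0 : ℝ) t,
        ((∫ x, partialP b₀ (fun y : PhaseSpace N => (u y + u (y.1, -y.2)) / 2) x * partialP b₀ (jt i s) x ∂μ) +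
          ∫ x, partialP b₁ (fun y : PhaseSpace N => (u y + u (y.1, -y.2)) / 2) x * partialP b₁ (jt i s) x ∂μ) :=
    fun i t ht => h7 i b₀ b₁ t rfl rfl ht
  have h6' := h6 b₀ b₁ rfl rfl
  have hE1' := (hE1 N u hu3).2
  obtain ⟨hD0, hDle⟩ := response_bound_flat hω hl.le hβ.le γ N hT hγ ha hC₁ hC₂ hC₃ hflat hN hu1 hu2 hu3 h5
    b₀ b₁ rfl rfl h6' jt hjt hA7 hGK hE1' (hE2 N)
  -- conclude
  rw [hgk, abs_of_nonneg (by positivity)]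
  have hT2 : (0 : ℝ) < T ^ 2 := by positivity
  have e1 : ((N : ℝ) - 1) * T ^ 2 * (2 * K₁' / T ^ 2 + (a * γ * C₃ * T / 8) ^ 2 / T ^ 4) =
      ((N : ℝ) - 1) * (2 * K₁' + (a * γ * C₃) ^ 2 / 64) := by
    field_simp
    ring
  calc ((N : ℝ) - 1) * T ^ 2 * D
      ≤ ((N : ℝ) - 1) * T ^ 2 * (2 * K₁' / T ^ 2 + (a * γ * C₃ * T / 8) ^ 2 / T ^ 4) :=
        mul_le_mul_of_nonneg_left hDle (by positivity)
    _ = ((N : ℝ) - 1) * (2 * K₁' + (a * γ * C₃) ^ 2 / 64) := e1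
    _ ≤ (2 * K₁' + (a * γ * C₃) ^ 2 / 64) * N := by
        have h0 : 0 ≤ 2 * K₁' + (a * γ * C₃) ^ 2 / 64 := by positivity
        nlinarith [h0]

/-- **Step 5: assembly of the pointwise bounds into `GKLinear`** — `E1` at fixed constants is
definitionally the hypothesis of Step 4 (constant enlarged to `max C₁ 0`); `E2` becomes the `window`
form by `integral_transitionKernel_zero_friction` under the time integral (constant `max C₂ 0`);
Step 1 supplies `P♭`; `eventually_ge_atTop 16`. [folklore] -/
theorem gkLinear_of_cruxes : TapLeakBound → ConeScaleCorrector → SubBallisticWindow → GKLinear := by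
  intro hP hE1 hE2 ω₂ lam β γ hω hl hβ hγ T hT
  obtain ⟨a, C₃, ha, hC₃, hflat⟩ := tapLeakFlatAt_of_tapLeakBound hP hω hl hβ hγ hT
  obtain ⟨C₁, hC₁⟩ := hE1 ω₂ lam β γ hω hl hβ hγ T hT
  obtain ⟨C₂, hC₂⟩ := hE2 ω₂ lam β γ hω hl hβ hγ T hT
  refine ⟨2 * (64 * Real.sqrt (max C₁ 0 * max C₂ 0 * (1 + a)) / a + a * γ * C₃ / 32) + (a * γ * C₃) ^ 2 / 64, ?_⟩
  filter_upwards [eventually_ge_atTop 16] with N hN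
  have hZ0 : ∀ M : ℕ, 0 ≤ ∫ x, Real.exp (-((pinnedChain ω₂ lam β γ).hamiltonian M x) / T) ∂volume :=
    fun M => integral_nonneg fun _ => (Real.exp_pos _).le
  refine gk_abs_le_of_flat hω hl hβ hγ hT ha (le_max_right _ _) (le_max_right _ _) hC₃ hflat ?_ ?_ N hN
  · -- `E1` at fixed constants is definitionally the dictionary form (constant enlarged to `max C₁ 0`)
    intro M u hu3
    have h := hC₁ M u hu3
    refine ⟨h.1, h.2.trans ?_⟩
    have := hZ0 M
    gcongr
    exact le_max_left _ _
  · -- `E2`: the zero-friction kernel integral is the block current along `detFlow`, i.e. `window`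
    intro M k₁ k₂ hk hk₂ τ hτ
    have h := hC₂ M k₁ k₂ hk hk₂ τ hτ
    simp only [] at h
    have hw : ∀ x : PhaseSpace M,
        (∫ t in Ioc (0 : ℝ) τ, ∫ y, (∑ i : Fin M, (if k₁ ≤ i.val ∧ i.val < k₂ then
            (pinnedChain ω₂ lam β γ).bondCurrent M i y else 0))
          ∂((pinnedChain ω₂ lam β 0).transitionKernel M T T t.toNNReal x)) =
        window ω₂ lam β γ M k₁ k₂ τ x := by
      intro x
      unfold window
      refine setIntegral_congr_fun measurableSet_Ioc fun t ht => ?_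
      rw [integral_transitionKernel_zero_friction hω hl.le hβ.le, Real.coe_toNNReal _ ht.1.le]
      rfl
    simp_rw [hw] at h
    refine h.trans ?_
    have hkk : (0 : ℝ) ≤ (k₂ : ℝ) - k₁ := by
      have : (k₁ : ℝ) ≤ k₂ := by exact_mod_cast hk
      linarith
    have := hZ0 M
    gcongr
    exact le_max_left _ _

/-- **The crux `WitnessGlue` (stmt-AtomisticToContinuum-15160), from the line** — complete proof,
standard axioms. [folklore] -/
theorem witnessGlue_from_line : WitnessGlue :=
  witnessGlue_of_gkLinear gkLinear_of_cruxes

end Summit.AtomisticToContinuum.FouriersLaw.Cruxes.WitnessGlue.SingleScaleGkWitness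

end
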